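import Mathlib
import Summits.NavierStokesRegularity.NavierStokesRegularity.Theorems.EulerZoomLiouvillePowerGaugeEulerLiouvilleSelfSimilarKelvinFlowC2
import Summits.NavierStokesRegularity.NavierStokesRegularity.Theorems.EulerZoomLiouvillePowerGaugeEulerLiouvilleSelfSimilarSaddleContinuumPlane
import Summits.NavierStokesRegularity.NavierStokesRegularity.Theorems.EulerZoomLiouvillePowerGaugeEulerLiouvilleSelfSimilarBoundedExclusion
import HarnessLib.Audit

/-!
# Rung C1 of the crux `EulerZoomLiouville.PowerGaugeEulerLiouville` (W1 stage S4a): time-`T` linearisation at a node, iterated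
# flow, DOMINATED-BLOCK and CONTRACTING-PLANE trapped sets, the null-basin cover and the compact bad set — FOR `C²` PROFILES

Route №10 `EulerZoomLiouville` (NavierStokesRegularity), crux E = stmt-NavierStokesRegularity-19832, tenure rung C1,
registered residue `stub_selfSimilarExtremalRest`, sub-stratum W1 («`C²` but not `C^∞` profiles»).  Lineage ns-typeII-p2 (gen 8,
INTERIM LEAD).  `C²` twins (namespace `…PowerGaugeEulerLiouville.C2.Kelvin`, same short names as ns-typeII-p3's `…Kelvin`
originals, proofs verbatim) on the `C²` flow API `…SelfSimilarKelvinFlowC2` (S1: joint `C²` flow, `C²` variational equation).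
WHAT THIS IS NOT: not NS, not E, not rung C1 — thin-basin lemmas for `C²` profiles with bounded gradient.
[folklore; ConstantinIgnatovaVicol2026Putative §3.5 (setting); Robinson 1999 Ch. V (cone/trapped-set arguments, tree form)]
-/

noncomputable section

-- flat `Theorems/<Route><Decl>…` files of one crux share the namespace of the crux (tree convention)
set_option linter.dupNamespace false

open MeasureTheory Set Filter Topology Metric Function InnerProductSpace
open scoped RealInnerProductSpace NNReal ContDiff Nat

namespace Summit.NavierStokesRegularity.NavierStokesRegularity.Theorems.PowerGaugeEulerLiouville.C2.Kelvin

open Literature.Analysis Literature.Analysis.FluidPDE Literature.Dynamics.FixedPoints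
  Literature.Dynamics.TopologicalDynamics
open Summit.NavierStokesRegularity.NavierStokesRegularity.Theorems.PowerGaugeEulerLiouville.Kelvin

variable {γ : ℝ} {V : EuclideanSpace ℝ (Fin 3) → EuclideanSpace ℝ (Fin 3)} {P : EuclideanSpace ℝ (Fin 3) → ℝ}

/-- At a stagnation point `z` the variational equation has CONSTANT coefficients:
`d/ds D(Φ_s)(z) = DW(z) ∘ D(Φ_s)(z)`, `DW(z) = γI + DV(z)`. [cite: ConstantinIgnatovaVicol2026Putative, §3.4.1 eq. (3.22)] -/
theorem hasDerivAt_fderiv_flow_of_mem_nodalSet (hV : ContDiff ℝ 2 V) {K : ℝ} (hK : ∀ y, ‖fderiv ℝ V y‖ ≤ K)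
    {z : EuclideanSpace ℝ (Fin 3)} (hz : z ∈ selfSimilarNodalSet γ 0 V) (s : ℝ) :
    HasDerivAt (fun r => fderiv ℝ (ODE.evolutionMap (fun _ : ℝ => selfSimilarTransport γ 0 V) 0 r) z)
      ((γ • ContinuousLinearMap.id ℝ (EuclideanSpace ℝ (Fin 3)) + fderiv ℝ V z) *
        fderiv ℝ (ODE.evolutionMap (fun _ : ℝ => selfSimilarTransport γ 0 V) 0 s) z) s := by
  have hV1 : ContDiff ℝ 1 V := hV.of_le (by norm_num)
  have h := hasDerivAt_fderiv_flow (γ := γ) hV hK s z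
  rw [flow_eq_self_of_mem_nodalSet hV1 hK hz s] at h
  exact h

/-- **The linearised similarity flow at a stagnation point is the matrix exponential**:
`D(Φ_s)(z) = exp(s · DW(z))` for every `s ∈ ℝ` (both sides solve `X' = DW(z) X` with `X(0) = I`; uniqueness for the
globally Lipschitz linear field `X ↦ DW(z) X`).  In particular `D(Φ_1)(z) = exp DW(z)`, the operator whose hyperbolic
splitting the Stable Manifold Theorem consumes. [cite: Robinson1999, Ch. V §5.10.3 (flows: the time-one map)] -/
theorem fderiv_flow_eq_exp_smul (hV : ContDiff ℝ 2 V) {K : ℝ} (hK : ∀ y, ‖fderiv ℝ V y‖ ≤ K)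
    {z : EuclideanSpace ℝ (Fin 3)} (hz : z ∈ selfSimilarNodalSet γ 0 V) (s : ℝ) :
    fderiv ℝ (ODE.evolutionMap (fun _ : ℝ => selfSimilarTransport γ 0 V) 0 s) z =
      NormedSpace.exp (s • (γ • ContinuousLinearMap.id ℝ (EuclideanSpace ℝ (Fin 3)) + fderiv ℝ V z)) := by
  set A : EuclideanSpace ℝ (Fin 3) →L[ℝ] EuclideanSpace ℝ (Fin 3) :=
    γ • ContinuousLinearMap.id ℝ (EuclideanSpace ℝ (Fin 3)) + fderiv ℝ V z with hA
  have hf : ∀ t : ℝ, HasDerivAt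
      (fun r => fderiv ℝ (ODE.evolutionMap (fun _ : ℝ => selfSimilarTransport γ 0 V) 0 r) z)
      (A * fderiv ℝ (ODE.evolutionMap (fun _ : ℝ => selfSimilarTransport γ 0 V) 0 t) z) t ∧
      fderiv ℝ (ODE.evolutionMap (fun _ : ℝ => selfSimilarTransport γ 0 V) 0 t) z ∈ (univ : Set _) :=
    fun t => ⟨hasDerivAt_fderiv_flow_of_mem_nodalSet hV hK hz t, mem_univ _⟩
  have hg : ∀ t : ℝ, HasDerivAt (fun r : ℝ => NormedSpace.exp (r • A)) (A * NormedSpace.exp (t • A)) t ∧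
      NormedSpace.exp (t • A) ∈ (univ : Set _) :=
    fun t => ⟨hasDerivAt_exp_smul_const' A t, mem_univ _⟩
  have hv : ∀ _t : ℝ, LipschitzOnWith ‖A‖₊
      (fun U : EuclideanSpace ℝ (Fin 3) →L[ℝ] EuclideanSpace ℝ (Fin 3) => A * U) univ := by
    intro t
    refine (lipschitzWith_iff_norm_sub_le.2 fun U W => ?_).lipschitzOnWith
    rw [← mul_sub]
    exact norm_mul_le _ _
  have key := ODE_solution_unique_univ (v := fun _ U => A * U) (s := fun _ => univ) (t₀ := 0) hv hf hg ?_
  · exact congrFun key s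
  · show fderiv ℝ (ODE.evolutionMap (fun _ : ℝ => selfSimilarTransport γ 0 V) 0 0) z =
      NormedSpace.exp ((0 : ℝ) • A)
    rw [fderiv_evolutionMap_self, show ((0 : ℝ) • A) = 0 from zero_smul ℝ A, NormedSpace.exp_zero]
    rfl

/-- In particular **`D(Φ_1)(z) = exp DW(z)`** at every stagnation point `z`. [cite: Robinson1999, Ch. V §5.10.3 (flows: the time-one map)] -/
theorem fderiv_flow_one_eq_exp (hV : ContDiff ℝ 2 V) {K : ℝ} (hK : ∀ y, ‖fderiv ℝ V y‖ ≤ K)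
    {z : EuclideanSpace ℝ (Fin 3)} (hz : z ∈ selfSimilarNodalSet γ 0 V) :
    fderiv ℝ (ODE.evolutionMap (fun _ : ℝ => selfSimilarTransport γ 0 V) 0 1) z =
      NormedSpace.exp (γ • ContinuousLinearMap.id ℝ (EuclideanSpace ℝ (Fin 3)) + fderiv ℝ V z) := by
  rw [fderiv_flow_eq_exp_smul hV hK hz 1,
    show ((1 : ℝ) • (γ • ContinuousLinearMap.id ℝ (EuclideanSpace ℝ (Fin 3)) + fderiv ℝ V z)) =
      γ • ContinuousLinearMap.id ℝ (EuclideanSpace ℝ (Fin 3)) + fderiv ℝ V z from one_smul ℝ _]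

/-- Integer iterates of a sampling map are flow times: `(Φ_T)^[n] = Φ_{nT}`. [folklore] -/
theorem iterate_flow_eq (hV : ContDiff ℝ 2 V) {K : ℝ} (hK : ∀ y, ‖fderiv ℝ V y‖ ≤ K) (T : ℝ) (n : ℕ)
    (y : EuclideanSpace ℝ (Fin 3)) :
    (ODE.evolutionMap (fun _ : ℝ => selfSimilarTransport γ 0 V) 0 T)^[n] y =
      ODE.evolutionMap (fun _ : ℝ => selfSimilarTransport γ 0 V) 0 ((n : ℝ) * T) y := by
  have hV1 : ContDiff ℝ 1 V := hV.of_le (by norm_num)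
  induction n with
  | zero => simp
  | succ n ih =>
      rw [Function.iterate_succ_apply', ih, ← flow_add (γ := γ) hV1 hK]
      congr 1; push_cast; ring

/-- **Null trapped set at a dominated-block node.**  `V` smooth with `‖DV‖ ≤ K`, `z ∈ 𝒩_W`, `DW(z)` in real block
form with `d₂ < 0`, `d₂ < d₀`, `d₂ < d₁`: there are `T > 0` and `r > 0` such that the set of points admitting a
`Φ_T`-past history inside `B(z, r)` is Lebesgue-null. [cite: Robinson1999, Ch. V §5.10.1 (cone estimate, dominated form; proved in the tree)] -/
theorem exists_trappedSet_null_of_dominatedBlock (hV : ContDiff ℝ 2 V) {K : ℝ} (hK : ∀ y, ‖fderiv ℝ V y‖ ≤ K)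
    {z : EuclideanSpace ℝ (Fin 3)} (hz : z ∈ selfSimilarNodalSet γ 0 V)
    (b : Module.Basis (Fin 3) ℝ (EuclideanSpace ℝ (Fin 3))) (lam : Fin 3 → ℝ) (β : ℝ)
    (hA0 : (γ • ContinuousLinearMap.id ℝ (EuclideanSpace ℝ (Fin 3)) + fderiv ℝ V z) (b 0) = lam 0 • b 0 - β • b 1)
    (hA1 : (γ • ContinuousLinearMap.id ℝ (EuclideanSpace ℝ (Fin 3)) + fderiv ℝ V z) (b 1) = β • b 0 + lam 1 • b 1)
    (hA2 : (γ • ContinuousLinearMap.id ℝ (EuclideanSpace ℝ (Fin 3)) + fderiv ℝ V z) (b 2) = lam 2 • b 2)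
    (h2 : lam 2 < 0) (h20 : lam 2 < lam 0) (h21 : lam 2 < lam 1) :
    ∃ T : ℝ, 0 < T ∧ ∃ r : ℝ, 0 < r ∧ volume {q : EuclideanSpace ℝ (Fin 3) | ∃ qs : ℕ → EuclideanSpace ℝ (Fin 3),
      qs 0 = q ∧ (∀ k, ODE.evolutionMap (fun _ : ℝ => selfSimilarTransport γ 0 V) 0 T (qs (k + 1)) = qs k) ∧
        ∀ k, qs k ∈ ball z r} = 0 := by
  set A : EuclideanSpace ℝ (Fin 3) →L[ℝ] EuclideanSpace ℝ (Fin 3) :=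
    γ • ContinuousLinearMap.id ℝ (EuclideanSpace ℝ (Fin 3)) + fderiv ℝ V z with hA
  obtain ⟨c, hc, hplane⟩ := le_norm_exp_smul_apply_of_span_pair A b lam β hA0 hA1
  set μ : ℝ := min (lam 0) (lam 1) with hμ
  have hμ2 : lam 2 < μ := lt_min h20 h21
  set κ : ℝ := μ - lam 2 with hκ
  have hκ0 : 0 < κ := by rw [hκ]; linarith
  set T : ℝ := (1 / c) / κ + 1 with hTdef
  have hT0 : 0 < T := by rw [hTdef]; positivity
  have hrate : Real.exp (lam 2 * T) < c * Real.exp (μ * T) := by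
    have h1 : 1 / c < Real.exp (κ * T) := by
      have h2 : κ * T = 1 / c + κ := by rw [hTdef]; field_simp
      have h3 := Real.add_one_le_exp (κ * T)
      rw [h2] at h3 ⊢
      linarith
    have h4 : Real.exp (μ * T) = Real.exp (lam 2 * T) * Real.exp (κ * T) := by
      rw [← Real.exp_add]; congr 1; rw [hκ]; ring
    rw [h4]
    have h5 : 1 < c * Real.exp (κ * T) := by
      have := (div_lt_iff₀' hc).1 h1
      linarith
    nlinarith [Real.exp_pos (lam 2 * T)]
  have hexp := fderiv_flow_eq_exp_smul hV hK hz T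
  have hF : ContDiff ℝ 1 (ODE.evolutionMap (fun _ : ℝ => selfSimilarTransport γ 0 V) 0 T) :=
    (contDiff_flow (γ := γ) hV hK T).of_le (by norm_cast)
  obtain ⟨r, hr, hnull⟩ := hausdorffMeasure_localTrappedSet_eq_zero_of_dominated (p := z) hF
    (Es := Submodule.span ℝ {b 2}) (Ec := Submodule.span ℝ {b 0, b 1}) (isCompl_span_singleton_span_pair b)
    (fun x hx => by rw [hexp]; exact exp_smul_apply_mem A (mapsTo_span_singleton_of_blockBasis A b lam hA2) hx T)
    (fun x hx => by rw [hexp]; exact exp_smul_apply_mem A (mapsTo_span_pair_of_blockBasis A b lam β hA0 hA1) hx T)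
    (a := Real.exp (lam 2 * T)) (b := c * Real.exp (μ * T))
    (by
      have : lam 2 * T < 0 := mul_neg_of_neg_of_pos h2 hT0
      calc Real.exp (lam 2 * T) < Real.exp 0 := Real.exp_lt_exp.2 this
        _ = 1 := Real.exp_zero)
    hrate
    (fun x hx => by rw [hexp]; exact norm_exp_smul_apply_le_of_eigenline A b lam hA2 hx hT0.le)
    (fun x hx => by rw [hexp]; exact hplane T hT0.le x hx) (span_pair_ne_top b)
  exact ⟨T, hT0, r, hr,
    (Measure.absolutelyContinuous_isAddHaarMeasure volume (μH[Module.finrank ℝ (EuclideanSpace ℝ (Fin 3))])) hnull⟩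

/-- **Cover argument.**  `V` smooth with `‖DV‖ ≤ K`, `Kset` compact; if every `z ∈ Kset` has a sampling time `T > 0`
and a radius `r > 0` such that the set of points admitting a `Φ_T`-past history inside `B(z, r)` is null, then the set
of points whose backward trajectory converges to some point of `Kset` is null (finite sub-cover by half-balls, integer
sampling, `C¹` images of null sets). [folklore] -/
theorem volume_setOf_tendsto_flow_atBot_mem_eq_zero_of_trappedSets (hV : ContDiff ℝ 2 V) {K : ℝ}
    (hK : ∀ y, ‖fderiv ℝ V y‖ ≤ K) {Kset : Set (EuclideanSpace ℝ (Fin 3))} (hKc : IsCompact Kset)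
    (hdata : ∀ z ∈ Kset, ∃ T : ℝ, 0 < T ∧ ∃ r : ℝ, 0 < r ∧ volume {q : EuclideanSpace ℝ (Fin 3) |
      ∃ qs : ℕ → EuclideanSpace ℝ (Fin 3), qs 0 = q ∧
        (∀ k, ODE.evolutionMap (fun _ : ℝ => selfSimilarTransport γ 0 V) 0 T (qs (k + 1)) = qs k) ∧
        ∀ k, qs k ∈ ball z r} = 0) :
    volume {x : EuclideanSpace ℝ (Fin 3) | ∃ z ∈ Kset,
      Tendsto (fun s => ODE.evolutionMap (fun _ : ℝ => selfSimilarTransport γ 0 V) 0 s x) atBot (𝓝 z)} = 0 := by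
  have hV1 : ContDiff ℝ 1 V := hV.of_le (by norm_num)
  set Φ := ODE.evolutionMap (fun _ : ℝ => selfSimilarTransport γ 0 V) 0 with hΦ
  choose! T hT r hr hnull using hdata
  obtain ⟨t, htK, hcover⟩ := hKc.elim_nhds_subcover (fun z => ball z (r z / 2))
    (fun z hz => ball_mem_nhds z (half_pos (hr z hz)))
  have hWnull : ∀ i ∈ t, ∀ n : ℕ, volume ((Φ (T i))^[n] '' {q : EuclideanSpace ℝ (Fin 3) |
      ∃ qs : ℕ → EuclideanSpace ℝ (Fin 3), qs 0 = q ∧ (∀ k, Φ (T i) (qs (k + 1)) = qs k) ∧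
        ∀ k, qs k ∈ ball i (r i)}) = 0 := by
    intro i hi n
    have hFd : Differentiable ℝ (Φ (T i)) := (contDiff_flow (γ := γ) hV hK (T i)).differentiable (by simp)
    exact addHaar_image_eq_zero_of_differentiableOn_of_addHaar_eq_zero volume (hFd.iterate n).differentiableOn
      (hnull i (htK i hi))
  refine measure_mono_null (fun x hx => ?_)
    ((measure_biUnion_null_iff t.countable_toSet).2 fun i hi => measure_iUnion_null (hWnull i hi))
  obtain ⟨z, hzK, hz⟩ := hx
  obtain ⟨i, hi, hzi⟩ := mem_iUnion₂.1 (hcover hzK)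
  have hri : 0 < r i := hr i (htK i hi)
  have hsub : ball z (r i / 2) ⊆ ball i (r i) := by
    intro y hy
    rw [mem_ball] at hy hzi ⊢
    calc dist y i ≤ dist y z + dist z i := dist_triangle _ _ _
      _ < r i / 2 + r i / 2 := add_lt_add hy hzi
      _ = r i := by ring
  have hev : ∀ᶠ s in atBot, Φ s x ∈ ball i (r i) :=
    (hz.eventually (ball_mem_nhds z (half_pos hri))).mono fun s hs => hsub hs
  obtain ⟨S, hS⟩ := eventually_atBot.1 hev
  obtain ⟨n, hn⟩ := exists_nat_ge (-S / T i)
  have hTi : 0 < T i := hT i (htK i hi)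
  have hnS : -((n : ℝ) * T i) ≤ S := by
    have := (div_le_iff₀ hTi).1 hn
    linarith
  refine mem_iUnion₂.2 ⟨i, hi, mem_iUnion.2 ⟨n, ?_⟩⟩
  have hmem : Φ (-((n : ℝ) * T i)) x ∈ {q : EuclideanSpace ℝ (Fin 3) |
      ∃ qs : ℕ → EuclideanSpace ℝ (Fin 3), qs 0 = q ∧ (∀ k, Φ (T i) (qs (k + 1)) = qs k) ∧
        ∀ k, qs k ∈ ball i (r i)} := by
    refine ⟨fun k => Φ (-(((n : ℝ) + k) * T i)) x, by simp, fun k => ?_, fun k => hS _ ?_⟩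
    · show Φ (T i) (Φ (-(((n : ℝ) + ((k + 1 : ℕ) : ℝ)) * T i)) x) = Φ (-(((n : ℝ) + k) * T i)) x
      rw [hΦ, ← flow_add (γ := γ) hV1 hK]
      congr 1; push_cast; ring
    · have hk : (0 : ℝ) ≤ k := Nat.cast_nonneg k
      nlinarith
  refine ⟨Φ (-((n : ℝ) * T i)) x, hmem, ?_⟩
  rw [hΦ, iterate_flow_eq hV hK, ← flow_add (γ := γ) hV1 hK, add_neg_cancel]
  exact PowerGaugeEulerLiouville.Kelvin.flow_zero x

/-- **Null trapped set at a node with a dominated contracting PLANE.**  `V` smooth with `‖DV‖ ≤ K`, `z ∈ 𝒩_W`, and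
`DW(z)` in real block form `A b₀ = d₀b₀ − βb₁`, `A b₁ = βb₀ + d₁b₁`, `A b₂ = d₂b₂` with `d₀ < 0`, `d₁ < 0`, `d₀ < d₂`,
`d₁ < d₂` (a complex pair with negative real part, or two negative real rates, below the third rate).  Then for some
`T > 0`, `r > 0`, the set of points admitting a `Φ_T`-past history inside `B(z, r)` is null (`Es = span{b₀,b₁}`,
rate `≤ √(‖G‖/g₀)·e^{max(d₀,d₁)T} < 1`; `Ec = span{b₂}`, rate `e^{d₂T}`).
[cite: Robinson1999, Ch. V §5.10.1 (cone estimate, dominated form; proved in the tree)] -/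
theorem exists_trappedSet_null_of_contractingPlane (hV : ContDiff ℝ 2 V) {K : ℝ} (hK : ∀ y, ‖fderiv ℝ V y‖ ≤ K)
    {z : EuclideanSpace ℝ (Fin 3)} (hz : z ∈ selfSimilarNodalSet γ 0 V)
    (b : Module.Basis (Fin 3) ℝ (EuclideanSpace ℝ (Fin 3))) (lam : Fin 3 → ℝ) (β : ℝ)
    (hA0 : (γ • ContinuousLinearMap.id ℝ (EuclideanSpace ℝ (Fin 3)) + fderiv ℝ V z) (b 0) = lam 0 • b 0 - β • b 1)
    (hA1 : (γ • ContinuousLinearMap.id ℝ (EuclideanSpace ℝ (Fin 3)) + fderiv ℝ V z) (b 1) = β • b 0 + lam 1 • b 1)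
    (hA2 : (γ • ContinuousLinearMap.id ℝ (EuclideanSpace ℝ (Fin 3)) + fderiv ℝ V z) (b 2) = lam 2 • b 2)
    (h0 : lam 0 < 0) (h1 : lam 1 < 0) (h02 : lam 0 < lam 2) (h12 : lam 1 < lam 2) :
    ∃ T : ℝ, 0 < T ∧ ∃ r : ℝ, 0 < r ∧ volume {q : EuclideanSpace ℝ (Fin 3) | ∃ qs : ℕ → EuclideanSpace ℝ (Fin 3),
      qs 0 = q ∧ (∀ k, ODE.evolutionMap (fun _ : ℝ => selfSimilarTransport γ 0 V) 0 T (qs (k + 1)) = qs k) ∧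
        ∀ k, qs k ∈ ball z r} = 0 := by
  set A : EuclideanSpace ℝ (Fin 3) →L[ℝ] EuclideanSpace ℝ (Fin 3) :=
    γ • ContinuousLinearMap.id ℝ (EuclideanSpace ℝ (Fin 3)) + fderiv ℝ V z with hA
  set Λ : ℝ := max (lam 0) (lam 1) with hΛ
  have hΛ0 : Λ < 0 := max_lt h0 h1
  have hΛ2 : Λ < lam 2 := max_lt h02 h12
  -- Lyapunov pair on the plane, with the UPPER bound `⟪GAh,h⟫ ≤ Λ⟪Gh,h⟫`
  obtain ⟨G, hGsym, ⟨g₀, hg₀, hGpos⟩, hGA⟩ := exists_adapted_on_span_pair A b lam β hA0 hA1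
    (μ₀ := min (lam 0) (lam 1)) (Λ₀ := Λ) (min_le_left _ _) (min_le_right _ _) (le_max_left _ _) (le_max_right _ _)
  have hGx : ∀ y, ⟪G y, y⟫ ≤ ‖G‖ * ‖y‖ ^ 2 := fun y => by
    calc ⟪G y, y⟫ ≤ ‖G y‖ * ‖y‖ := real_inner_le_norm _ _
      _ ≤ ‖G‖ * ‖y‖ * ‖y‖ := mul_le_mul_of_nonneg_right (G.le_opNorm y) (norm_nonneg _)
      _ = ‖G‖ * ‖y‖ ^ 2 := by ring
  have hGn : 0 < ‖G‖ := by
    have hb0 : b 0 ≠ 0 := b.ne_zero 0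
    have h1' := hGpos (b 0)
    have h2' := hGx (b 0)
    have h3 : 0 < g₀ * ‖b 0‖ ^ 2 := mul_pos hg₀ (pow_pos (norm_pos_iff.2 hb0) 2)
    by_contra hcon
    push Not at hcon
    have : ‖G‖ = 0 := le_antisymm hcon (norm_nonneg _)
    rw [this, zero_mul] at h2'
    linarith
  set c₀ : ℝ := Real.sqrt (‖G‖ / g₀) with hc₀
  have hc₀pos : 0 < c₀ := Real.sqrt_pos.2 (div_pos hGn hg₀)
  -- sampling time: `e^{κT} > c₀` with `κ = min (−Λ) (d₂ − Λ) > 0`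
  set κ : ℝ := min (-Λ) (lam 2 - Λ) with hκ
  have hκ0 : 0 < κ := lt_min (by linarith) (by linarith)
  set T : ℝ := c₀ / κ + 1 with hTdef
  have hT0 : 0 < T := by rw [hTdef]; positivity
  have hκT : c₀ < Real.exp (κ * T) := by
    have h2 : κ * T = c₀ + κ := by rw [hTdef]; field_simp
    have h3 := Real.add_one_le_exp (κ * T)
    rw [h2] at h3 ⊢
    linarith
  -- the rates
  set a : ℝ := c₀ * Real.exp (Λ * T) with ha
  have ha1 : a < 1 := by
    -- `c₀ e^{ΛT} < e^{κT} e^{ΛT} ≤ e^{−ΛT} e^{ΛT} = 1`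
    have h1' : Real.exp (κ * T) ≤ Real.exp (-Λ * T) :=
      Real.exp_le_exp.2 (mul_le_mul_of_nonneg_right (min_le_left _ _) hT0.le)
    have h2' : Real.exp (-Λ * T) * Real.exp (Λ * T) = 1 := by rw [← Real.exp_add]; ring_nf; simp
    calc a = c₀ * Real.exp (Λ * T) := rfl
      _ < Real.exp (κ * T) * Real.exp (Λ * T) := mul_lt_mul_of_pos_right hκT (Real.exp_pos _)
      _ ≤ Real.exp (-Λ * T) * Real.exp (Λ * T) := mul_le_mul_of_nonneg_right h1' (Real.exp_pos _).le
      _ = 1 := h2'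
  have hab : a < Real.exp (lam 2 * T) := by
    have h1' : Real.exp (κ * T) ≤ Real.exp ((lam 2 - Λ) * T) :=
      Real.exp_le_exp.2 (mul_le_mul_of_nonneg_right (min_le_right _ _) hT0.le)
    have h2' : Real.exp ((lam 2 - Λ) * T) * Real.exp (Λ * T) = Real.exp (lam 2 * T) := by
      rw [← Real.exp_add]; ring_nf
    calc a = c₀ * Real.exp (Λ * T) := rfl
      _ < Real.exp (κ * T) * Real.exp (Λ * T) := mul_lt_mul_of_pos_right hκT (Real.exp_pos _)
      _ ≤ Real.exp ((lam 2 - Λ) * T) * Real.exp (Λ * T) := mul_le_mul_of_nonneg_right h1' (Real.exp_pos _).le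
      _ = Real.exp (lam 2 * T) := h2'
  have hexp := fderiv_flow_eq_exp_smul hV hK hz T
  have hF : ContDiff ℝ 1 (ODE.evolutionMap (fun _ : ℝ => selfSimilarTransport γ 0 V) 0 T) :=
    (contDiff_flow (γ := γ) hV hK T).of_le (by norm_cast)
  -- upper rate on the plane
  have hplane : ∀ x ∈ Submodule.span ℝ ({b 0, b 1} : Set (EuclideanSpace ℝ (Fin 3))),
      ‖NormedSpace.exp (T • A) x‖ ≤ a * ‖x‖ := by
    intro x hx
    have hle : ∀ h ∈ Submodule.span ℝ ({b 0, b 1} : Set (EuclideanSpace ℝ (Fin 3))), ⟪G (A h), h⟫ ≤ -(-Λ) * ⟪G h, h⟫ :=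
      fun h hh => by rw [neg_neg]; exact (hGA h hh).2
    have h := inner_exp_smul_apply_le A G (mapsTo_span_pair_of_blockBasis A b lam β hA0 hA1) hGsym hle hx hT0.le
    set y := NormedSpace.exp (T • A) x with hy
    -- `g₀‖y‖² ≤ ⟪Gy,y⟫ ≤ e^{2ΛT}⟪Gx,x⟫ ≤ e^{2ΛT}‖G‖‖x‖²`
    have h1' : g₀ * ‖y‖ ^ 2 ≤ Real.exp (-(2 * -Λ) * T) * (‖G‖ * ‖x‖ ^ 2) :=
      (hGpos y).trans (h.trans (mul_le_mul_of_nonneg_left (hGx x) (Real.exp_pos _).le))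
    have h2' : ‖y‖ ^ 2 ≤ (a * ‖x‖) ^ 2 := by
      rw [ha, mul_pow, mul_pow, hc₀, Real.sq_sqrt (div_pos hGn hg₀).le, ← Real.exp_nat_mul]
      rw [div_mul_eq_mul_div, div_mul_eq_mul_div, le_div_iff₀ hg₀]
      calc ‖y‖ ^ 2 * g₀ = g₀ * ‖y‖ ^ 2 := by ring
        _ ≤ Real.exp (-(2 * -Λ) * T) * (‖G‖ * ‖x‖ ^ 2) := h1'
        _ = ‖G‖ * Real.exp (↑2 * (Λ * T)) * ‖x‖ ^ 2 := by ring_nf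
    have ha0 : 0 ≤ a * ‖x‖ := by positivity
    exact (pow_le_pow_iff_left₀ (norm_nonneg _) ha0 two_ne_zero).1 h2'
  -- lower rate on the line
  have hline : ∀ x ∈ Submodule.span ℝ ({b 2} : Set (EuclideanSpace ℝ (Fin 3))),
      Real.exp (lam 2 * T) * ‖x‖ ≤ ‖NormedSpace.exp (T • A) x‖ := by
    intro x hx
    have hge : ∀ h ∈ Submodule.span ℝ ({b 2} : Set (EuclideanSpace ℝ (Fin 3))),
        lam 2 * ⟪(ContinuousLinearMap.id ℝ _) h, h⟫ ≤ ⟪(ContinuousLinearMap.id ℝ _) (A h), h⟫ := by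
      intro h hh
      rw [ContinuousLinearMap.id_apply, ContinuousLinearMap.id_apply,
        inner_apply_self_of_mem_span_singleton A b lam hA2 hh, real_inner_self_eq_norm_sq]
    have h := inner_exp_smul_apply_ge A (ContinuousLinearMap.id ℝ _) (mapsTo_span_singleton_of_blockBasis A b lam hA2)
      (fun u v => by simp) hge hx hT0.le
    rw [ContinuousLinearMap.id_apply, ContinuousLinearMap.id_apply, real_inner_self_eq_norm_sq,
      real_inner_self_eq_norm_sq] at h
    have h2' : (Real.exp (lam 2 * T) * ‖x‖) ^ 2 ≤ ‖NormedSpace.exp (T • A) x‖ ^ 2 := by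
      calc (Real.exp (lam 2 * T) * ‖x‖) ^ 2 = Real.exp (2 * lam 2 * T) * ‖x‖ ^ 2 := by
            rw [mul_pow, ← Real.exp_nat_mul]; ring_nf
        _ ≤ ‖NormedSpace.exp (T • A) x‖ ^ 2 := h
    exact (pow_le_pow_iff_left₀ (by positivity) (norm_nonneg _) two_ne_zero).1 h2'
  obtain ⟨r, hr, hnull⟩ := hausdorffMeasure_localTrappedSet_eq_zero_of_dominated (p := z) hF
    (Es := Submodule.span ℝ {b 0, b 1}) (Ec := Submodule.span ℝ {b 2}) (isCompl_span_singleton_span_pair b).symm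
    (fun x hx => by rw [hexp]; exact exp_smul_apply_mem A (mapsTo_span_pair_of_blockBasis A b lam β hA0 hA1) hx T)
    (fun x hx => by rw [hexp]; exact exp_smul_apply_mem A (mapsTo_span_singleton_of_blockBasis A b lam hA2) hx T)
    (a := a) (b := Real.exp (lam 2 * T)) ha1 hab
    (fun x hx => by rw [hexp]; exact hplane x hx)
    (fun x hx => by rw [hexp]; exact hline x hx) (span_singleton_ne_top b)
  exact ⟨T, hT0, r, hr,
    (Measure.absolutelyContinuous_isAddHaarMeasure volume (μH[Module.finrank ℝ (EuclideanSpace ℝ (Fin 3))])) hnull⟩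

/-- **The bad set of a bounded profile is compact**: `𝒩_W ⊆ B̄(0, M/γ)` (`γ z = −V z`), `𝒩_W` is closed, and the bad
condition `∃ w, ‖w‖ = 1 ∧ 1 ≤ ⟪DV(z) w, w⟫` is closed (p1's `isClosed_badSet`). [folklore] -/
theorem isCompact_badNodalSet_of_bounded (hV : ContDiff ℝ 2 V) (hprof : IsSelfSimilarEulerProfile γ 0 V P)
    (hγ : 0 < γ) {M : ℝ} (hM : ∀ y, ‖V y‖ ≤ M) :
    IsCompact {z : EuclideanSpace ℝ (Fin 3) | z ∈ selfSimilarNodalSet γ 0 V ∧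
      ∃ w : EuclideanSpace ℝ (Fin 3), ‖w‖ = 1 ∧ 1 ≤ ⟪fderiv ℝ V z w, w⟫} := by
  have hWc : Continuous (selfSimilarTransport γ 0 V) := (PowerGaugeEulerLiouville.Kelvin.contDiff_selfSimilarTransport (γ := γ) hV).continuous
  have hNcl : IsClosed (selfSimilarNodalSet γ 0 V) := isClosed_eq hWc continuous_const
  have hNbdd : selfSimilarNodalSet γ 0 V ⊆ closedBall (0 : EuclideanSpace ℝ (Fin 3)) (M / γ) := by
    intro z hz
    rw [mem_selfSimilarNodalSet_iff, sub_zero] at hz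
    have h1 : γ • z = -V z := eq_neg_of_add_eq_zero_left hz
    have h2 : γ * ‖z‖ = ‖V z‖ := by
      rw [← norm_neg (V z), ← h1, norm_smul, Real.norm_of_nonneg hγ.le]
    rw [mem_closedBall, dist_zero_right, le_div_iff₀ hγ, mul_comm, h2]
    exact hM z
  have hcpt : IsCompact (selfSimilarNodalSet γ 0 V) := (isCompact_closedBall _ _).of_isClosed_subset hNcl hNbdd
  rw [setOf_and]
  exact hcpt.inter_right (NodalContinuum.isClosed_badSet hprof)

end Summit.NavierStokesRegularity.NavierStokesRegularity.Theorems.PowerGaugeEulerLiouville.C2.Kelvin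

end
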